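import Summits.QuantumFields.YangMills.Theorems.BalabanUVNodesN15BackgroundRelativeForms
import Summits.QuantumFields.YangMills.Theorems.BalabanUVNodesN15UnitReadout
import Summits.QuantumFields.YangMills.Theorems.BalabanUVNodesN15BackgroundUnitByName
import HarnessLib

/-!
# Route «BalabanUVNodes» (K4 «SpineRates»), node N15 = NE2 — THE UNIT-LATTICE LAYER WITH THE BACKGROUND LIVE, RELATIVE FORM: `T4EtaRate.NE2PlusUnit` BY NAME on g3's gauge paired
# instances for the dressed unit covariance `[K₀ + P(A′)]⁻¹`, `K₀` an ABSTRACT `U ≡ 1` unit form with NE2⁰-TYPE letters (decaying inverse, `K₀W = 1`, η-defect letter — King's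
# printed A = 0 template), `P(A′)` the dressing words of the piece — the honest repair of U3 (no piece-specific invertibility displayed)

Cell `pub-ymgap`, seat `pub-ymgap-dag-n15-c` (generation g5; R134 ACCELERATION SEAT, strategy s1; HUMAN RULING D-0062; chair R424 venue; `bears_on: R4∕N15`).  Filed
`--supports stmt-QuantumFields-20292 --as helper` (K3⁗; count-neutral).  Imports this seat's R1 `…N15BackgroundRelativeForms` (`hasMaj_idef_dressedUnitRel`, `uAmpRel`), U3
`…N15BackgroundUnitByName` (`cLinU`, `cAmpU_le_lin`), U2 `…N15UnitReadout`, and through them S5's `site_thresholds`, F14's `vWC_letters_of_gauge` BY NAME; nothing in the tree is modified.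

WHAT THIS FILE IS (U3 with the `U ≡ 1` unit form ABSTRACT).  §1 ★ `hasMaj_idef_vWUnitRelC` (per configuration).  §2 `vWUnitRelOpsC`, `vWGCUnitRelKernel`, ★★★ **`ne2PlusUnit_vWGC_rel`** —
`NE2PlusUnit c₃₅` BY NAME; displayed `U ≡ 1` data: the `U ≡ 1` layer's letters, and for the ABSTRACT unit forms `Ku i, Ku′ i`: inverses `Ws i, Ws′ i` with a uniform majorant, `Ku∘Ws = 1`,
and the η-defect letter `𝔇(Ku′ i, Ku i) ≤ M₀θ_i·e^{−δd}` (the NE2⁰ unit layer — [King1986] Lemma 4.5 (4.38); theorems of n15-d∕-e for King's scalar tower).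

HONEST FRAMING ∕ LIMITS.  As U3, with the piece-specific invertibility hypothesis REPLACED by the three NE2⁰-type letters of an abstract `U ≡ 1` unit form (so the displayed data are
the A = 0 layer's, printed for King's model; for Bałaban's `C^{(k)}(Λ)` NOT PRINTED); the dressing is the piece's (LINEAR vector single-scale piece ⊗ 1_𝔤, (3.60)-shaped `V′(A′)`,
fibrewise-mean transport).  NE2⁺ NOT PRINTED, NOT proved; count-neutral (typed 28∕28; discharged count unchanged); N15 NOT discharged; one finite T⁴ at fixed ε — NOT infinite volume,
NOT OS on ℝ⁴, NOT a mass gap, NOT Clay.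
-/

noncomputable section

open scoped BigOperators

namespace Summit.QuantumFields.YangMills.BalabanUVNodes.N15.SiteLayer

open Literature.MathematicalPhysics.QuantumFieldTheory.Balaban1983to89
open Literature.MathematicalPhysics.QuantumFieldTheory.Balaban1983to89.B11SectG (BlockNorm HasMaj RowSum)
open Literature.MathematicalPhysics.QuantumFieldTheory.Balaban1983to89.T4EtaRate (PairedInstance EtaRateIneqUnit NE2PlusUnit)
open Literature.MathematicalPhysics.QuantumFieldTheory.Balaban1983to89.T4EtaRateDefect (idef)
open Literature.MathematicalPhysics.QuantumFieldTheory.Balaban1983to89.T4EtaRateCoeffDefect (pull diagK diagK_mono fibre)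
open Literature.MathematicalPhysics.QuantumFieldTheory.Balaban1983to89.B6RandomWalk (Triangle254)
open Literature.MathematicalPhysics.QuantumFieldTheory.Balaban1983to89.B9SectDSup (inv_one_sub_le_two)
open Summit.QuantumFields.YangMills.BalabanUVNodes.N15.OperatorReadout (opGeo opGeo_len)
open Summit.QuantumFields.YangMills.BalabanUVNodes.N15.MatrixSpecies (liftMap liftBlk basisConst basisConst_nonneg)
open Summit.QuantumFields.YangMills.BalabanUVNodes.N15.BackgroundLayer (blkPair liftPair bgConst bgConst_nonneg vWPert vWR gVWc35 le_gVWc35 vWC_letters_of_gauge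
  v1coefC v1coefA v1fieldsOfGauge gavgM v1GaugeBg v1GaugeInstance)

/-! ## §2 Per configuration: the dressed unit covariances' η-defect with the full perturbation live -/

section Config

variable {X X' Y J ι : Type} [Fintype X] [Fintype X'] [Fintype Y] [Fintype J] [Fintype ι] [DecidableEq X] [DecidableEq X'] [DecidableEq Y] [DecidableEq J]
  [DecidableEq ι] {𝔄 : Type} [NormedRing 𝔄] [NormedAlgebra ℝ 𝔄] [CompleteSpace 𝔄] (e : 𝔄 ≃L[ℝ] (ι → ℝ)) {g : B6.Geometry} (blk : X → g.Site)
  (blkY : Y → g.Site) (q : X × ι → Y) (π : X' → X) (a : ℝ)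
variable {G : (X × ι → ℝ) →ₗ[ℝ] (X × ι → ℝ)} {D : J ⊕ J → (X × ι → ℝ) →ₗ[ℝ] (X × ι → ℝ)} {G' : (X' × ι → ℝ) →ₗ[ℝ] (X' × ι → ℝ)}
  {D' : J ⊕ J → (X' × ι → ℝ) →ₗ[ℝ] (X' × ι → ℝ)}

/-- **THE η-DEFECT OF THE DRESSED UNIT COVARIANCES WITH THE FULL PERTURBATION LIVE, PER CONFIGURATION** (S5's `hasMaj_idef_vWSiteC` with the unit form).  Data of F14's `vWC_letters_of_gauge` (one gauge field `A′` with
(3.35) at `c`, commuting shifts, `C_π`-step-connected fibres, block-translation law, species words `W, W′` at `c_W·(2c′Mα₀)`), guard `2(2c′)a₀ ≤ 1`, `a₀ ≤ 1`,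
`β(gVWc35(2c′)a₀)c_r ≤ ½`; the `U ≡ 1` layer `G, D_μ` ∕ `G′, D′_μ` (`β·e^{−δd}`, defects `m₀θ·e^{−δd}`); averaging species `F₂, F₂*, F₂′, F₂*′ ≤ diagK (c_F·(2c′Mα₀))`, fits
`≤ diagK (c_F·(2c′Mα₀)·θ)`; uniform pairing fibres of `liftMap π ι` over the site lattice `Y` (`liftBlk blk ι = blkY ∘ q`); `U ≡ 1` site kernels `W_s, W_s′ ≤ β_W·e^{−δd}`,
`(a − a²QGQ*)W_s = 1`, `(a − a²Q′G′Q′*)W_s′ = 1`; unit guard `β_W·a²cAmpU(β, Ka₀, c_r, c_F(2c′)a₀)·c_r² ≤ ½`; `4σ ≤ δ`.  CONCLUSION: `𝔇(C′, C) ≤ uAmp·θ·e^{−(δ−4σ)d}`.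
[cite: Balaban1985BackgroundPropagators, (3.65)–(3.67) p.403 (mechanism); Thm 3.2 (3.48) p.398, (3.35) p.396, (3.60) p.402 (shapes)] -/
theorem hasMaj_idef_vWUnitRelC (htri : Triangle254 g) (hd : ∀ a b : g.Site, 0 ≤ g.dist a b) {σ cr : ℝ} (hσ : 0 ≤ σ) (hcr : 0 ≤ cr) (hrow : RowSum g σ cr)
    {s : J → X ≃ X} {s' : J → X' ≃ X'} {N Nf : ℕ} {δ β m₀ θ c c' a₀ M α₀ η η' Cπ cW cF βW : ℝ} (hσδ : 4 * σ ≤ δ) (hβ : 0 ≤ β) (hm₀ : 0 ≤ m₀) (hθ : 0 ≤ θ)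
    (hcomm : ∀ μ κ x, (s' μ).symm (s' κ x) = s' κ ((s' μ).symm x)) (hCπ : 0 ≤ Cπ)
    (hconn : ∀ (f : X' → 𝔄) (b : ℝ), (∀ κ x, ‖f (s' κ x) - f x‖ ≤ b) → ∀ x₁ x₂, π x₁ = π x₂ → ‖f x₁ - f x₂‖ ≤ Cπ * b)
    (hblk : ∀ μ x', π ((s' μ ^ N) x') = s μ (π x')) (hη' : 0 < η') (hη'η : η' ≤ η) (hη1 : η ≤ 1) (hηθ : η ≤ θ) (hN : η = N * η')
    (hc : 0 ≤ c) (hc'0 : 0 < c') (hcc' : (2 + Fintype.card J) * c ≤ c') (hθ' : (1 + Fintype.card J) * Cπ * (c * M * α₀) * η' ≤ c' * M * α₀ * θ)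
    (hM : 1 ≤ M) (hα₀ : 0 < α₀) (hMα : M * α₀ ≤ a₀) (ha₀ : 0 ≤ a₀) (ha₀1 : 2 * (2 * c' * a₀) ≤ 1)
    (hq : β * (gVWc35 J (basisConst e) (2 * c') cW * a₀) * cr ≤ 1 / 2) (hcW : 0 ≤ cW) (hcF : 0 ≤ cF) (hβW : 0 ≤ βW)
    (hq2 : βW * (a * a * cAmpU β (gVWc35 J (basisConst e) (2 * c') cW * a₀) cr (cF * (2 * c') * a₀)) * cr * cr ≤ 1 / 2)
    (hqY : ∀ p, liftBlk blk ι p = blkY (q p)) (hNf : Nf ≠ 0) (hfib : ∀ x, (fibre (liftMap π ι) x).card = Nf)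
    (hG : HasMaj (BlockNorm.ofBlocks g (liftBlk blk ι)) (BlockNorm.ofBlocks g (liftBlk blk ι)) G (fun y y' => β * Real.exp (-(δ * g.dist y y'))))
    (hD : ∀ μ, HasMaj (BlockNorm.ofBlocks g (liftBlk blk ι)) (BlockNorm.ofBlocks g (liftBlk blk ι)) (D μ) (fun y y' => β * Real.exp (-(δ * g.dist y y'))))
    (hG' : HasMaj (BlockNorm.ofBlocks g (liftBlk (blk ∘ π) ι)) (BlockNorm.ofBlocks g (liftBlk (blk ∘ π) ι)) G' (fun y y' => β * Real.exp (-(δ * g.dist y y'))))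
    (hD' : ∀ μ, HasMaj (BlockNorm.ofBlocks g (liftBlk (blk ∘ π) ι)) (BlockNorm.ofBlocks g (liftBlk (blk ∘ π) ι)) (D' μ) (fun y y' => β * Real.exp (-(δ * g.dist y y'))))
    (hDG : HasMaj (BlockNorm.ofBlocks g (liftBlk blk ι)) (BlockNorm.ofBlocks g (liftBlk (blk ∘ π) ι))
      (idef (pull (liftMap π ι)) (pull (liftMap π ι)) G' G) (fun y y' => m₀ * θ * Real.exp (-(δ * g.dist y y'))))
    (hDD : ∀ μ, HasMaj (BlockNorm.ofBlocks g (liftBlk blk ι)) (BlockNorm.ofBlocks g (liftBlk (blk ∘ π) ι))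
      (idef (pull (liftMap π ι)) (pull (liftMap π ι)) (D' μ) (D μ)) (fun y y' => m₀ * θ * Real.exp (-(δ * g.dist y y'))))
    {A' : J → X' → 𝔄} (hreg : (v1GaugeBg 𝔄 J s' η' M).Reg335 c α₀ A')
    {W : (X × ι → ℝ) →ₗ[ℝ] (X × ι → ℝ)} {W' : (X' × ι → ℝ) →ₗ[ℝ] (X' × ι → ℝ)}
    (hW : HasMaj (BlockNorm.ofBlocks g (liftBlk blk ι)) (BlockNorm.ofBlocks g (liftBlk blk ι)) W (diagK fun _ => cW * (2 * c' * M * α₀)))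
    (hW' : HasMaj (BlockNorm.ofBlocks g (liftBlk (blk ∘ π) ι)) (BlockNorm.ofBlocks g (liftBlk (blk ∘ π) ι)) W' (diagK fun _ => cW * (2 * c' * M * α₀)))
    (hDW : HasMaj (BlockNorm.ofBlocks g (liftBlk blk ι)) (BlockNorm.ofBlocks g (liftBlk (blk ∘ π) ι))
      (idef (pull (liftMap π ι)) (pull (liftMap π ι)) W' W) (diagK fun _ => cW * (2 * c' * M * α₀) * θ))
    {F : (X × ι → ℝ) →ₗ[ℝ] (Y → ℝ)} {Fs : (Y → ℝ) →ₗ[ℝ] (X × ι → ℝ)} {F' : (X' × ι → ℝ) →ₗ[ℝ] (Y → ℝ)} {Fs' : (Y → ℝ) →ₗ[ℝ] (X' × ι → ℝ)}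
    (hF : HasMaj (BlockNorm.ofBlocks g (liftBlk blk ι)) (BlockNorm.ofBlocks g blkY) F (diagK fun _ => cF * (2 * c' * M * α₀)))
    (hFs : HasMaj (BlockNorm.ofBlocks g blkY) (BlockNorm.ofBlocks g (liftBlk blk ι)) Fs (diagK fun _ => cF * (2 * c' * M * α₀)))
    (hF' : HasMaj (BlockNorm.ofBlocks g (liftBlk (blk ∘ π) ι)) (BlockNorm.ofBlocks g blkY) F' (diagK fun _ => cF * (2 * c' * M * α₀)))
    (hFs' : HasMaj (BlockNorm.ofBlocks g blkY) (BlockNorm.ofBlocks g (liftBlk (blk ∘ π) ι)) Fs' (diagK fun _ => cF * (2 * c' * M * α₀)))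
    (hDF : HasMaj (BlockNorm.ofBlocks g (liftBlk blk ι)) (BlockNorm.ofBlocks g blkY) (idef (pull (liftMap π ι)) LinearMap.id F' F)
      (diagK fun _ => cF * (2 * c' * M * α₀) * θ))
    (hDFs : HasMaj (BlockNorm.ofBlocks g blkY) (BlockNorm.ofBlocks g (liftBlk (blk ∘ π) ι)) (idef LinearMap.id (pull (liftMap π ι)) Fs' Fs)
      (diagK fun _ => cF * (2 * c' * M * α₀) * θ))
    {Ws Ws' Ku Ku' : (Y → ℝ) →ₗ[ℝ] (Y → ℝ)} {M₀ : ℝ} (hM₀ : 0 ≤ M₀)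
    (hWs : HasMaj (BlockNorm.ofBlocks g blkY) (BlockNorm.ofBlocks g blkY) Ws (fun y y' => βW * Real.exp (-(δ * g.dist y y'))))
    (hWs' : HasMaj (BlockNorm.ofBlocks g blkY) (BlockNorm.ofBlocks g blkY) Ws' (fun y y' => βW * Real.exp (-(δ * g.dist y y'))))
    (hKW : Ku ∘ₗ Ws = LinearMap.id) (hKW' : Ku' ∘ₗ Ws' = LinearMap.id)
    (hDKu : HasMaj (BlockNorm.ofBlocks g blkY) (BlockNorm.ofBlocks g blkY) (idef LinearMap.id LinearMap.id Ku' Ku) (fun y y' => M₀ * θ * Real.exp (-(δ * g.dist y y')))) :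
    HasMaj (BlockNorm.ofBlocks g blkY) (BlockNorm.ofBlocks g blkY)
      (idef LinearMap.id LinearMap.id
        (siteInv Ws' Ku' (Ku' + (unitForm a (q ∘ liftMap π ι) F' Fs'
          (dressedOp G' D' (vWPert (v1coefC e η' (v1fieldsOfGauge 𝔄 J s' η' A')) (v1coefA e η' (v1fieldsOfGauge 𝔄 J s' η' A')) W')) -
          unitForm₀ a (q ∘ liftMap π ι) G')))
        (siteInv Ws Ku (Ku + (unitForm a q F Fs
          (dressedOp G D (vWPert (v1coefC e η (v1fieldsOfGauge 𝔄 J s η (gavgM 𝔄 J π A'))) (v1coefA e η (v1fieldsOfGauge 𝔄 J s η (gavgM 𝔄 J π A'))) W)) -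
          unitForm₀ a q G))))
      (fun y y' => uAmpRel β (gVWc35 J (basisConst e) (2 * c') cW * a₀) cr (cF * (2 * c') * a₀) m₀ (gVWc35 J (basisConst e) (2 * c') cW) a₀
        (cF * (2 * c') * a₀) βW a M₀ * θ * Real.exp (-((δ - 4 * σ) * g.dist y y'))) := by
  obtain ⟨hR0, hRa, hV, hV', hDV⟩ :=
    vWC_letters_of_gauge e (g := g) blk π hcomm hCπ hconn hblk hη' hη'η hη1 hηθ hN hc hc'0 hcc' hθ' hM hα₀ hMα ha₀1 hcW hreg hW hW' hDW
  set K : ℝ := gVWc35 J (basisConst e) (2 * c') cW with hKdef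
  have hK : 0 ≤ K := (le_gVWc35 (J := J) (basisConst_nonneg e) (by positivity : 0 < 2 * c') hcW).2.1.le
  have hθ0 : 0 ≤ θ := hθ
  have hV₁ := hV.mono fun y y' => diagK_mono (fun _ => hRa) y y'
  have hV₁' := hV'.mono fun y y' => diagK_mono (fun _ => hRa) y y'
  have hDV₁ := hDV.mono fun y y' => diagK_mono (fun _ => mul_le_mul_of_nonneg_right hRa hθ0) y y'
  have hr : cF * (2 * c' * M * α₀) ≤ cF * (2 * c') * a₀ := by
    have : 2 * c' * M * α₀ = 2 * c' * (M * α₀) := by ring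
    rw [this, mul_assoc cF]
    exact mul_le_mul_of_nonneg_left (mul_le_mul_of_nonneg_left hMα (by positivity)) hcF
  have hr0 : 0 ≤ cF * (2 * c') * a₀ := by positivity
  have hF₁ := hF.mono fun y y' => diagK_mono (fun _ => hr) y y'
  have hFs₁ := hFs.mono fun y y' => diagK_mono (fun _ => hr) y y'
  have hF₁' := hF'.mono fun y y' => diagK_mono (fun _ => hr) y y'
  have hFs₁' := hFs'.mono fun y y' => diagK_mono (fun _ => hr) y y'
  have hDF₁ := hDF.mono fun y y' => diagK_mono (fun _ => mul_le_mul_of_nonneg_right hr hθ0) y y'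
  have hDFs₁ := hDFs.mono fun y y' => diagK_mono (fun _ => mul_le_mul_of_nonneg_right hr hθ0) y y'
  exact hasMaj_idef_dressedUnitRel htri hd hrow hσ hcr (liftBlk blk ι) blkY q (liftMap π ι) hqY hNf hfib a hσδ hβ hm₀ hθ hK ha₀ hq (mul_nonneg hK ha₀) le_rfl
    hr0 hr0 hβW hM₀ hq2 hG hD hG' hD' hDG hDD hV₁ hV₁' hDV₁ hF₁ hFs₁ hF₁' hFs₁' hDF₁ hDFs₁ hWs hWs' hKW hKW' hDKu

end Config

/-! ## §3 The unit-covariance family on the gauge paired instances, and the node's third conjunct BY NAME -/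

section Node

variable {I J ι : Type} [Fintype J] [DecidableEq J] [Fintype ι] [DecidableEq ι] {𝔄 : Type} [NormedRing 𝔄] [NormedAlgebra ℝ 𝔄] [CompleteSpace 𝔄]
  (e : 𝔄 ≃L[ℝ] (ι → ℝ)) (g : I → B6.Geometry) (X X' Y : I → Type) [∀ i, Fintype (X i)] [∀ i, Fintype (X' i)] [∀ i, Fintype (Y i)] [∀ i, DecidableEq (X i)]
  [∀ i, DecidableEq (X' i)] [∀ i, DecidableEq (Y i)] (blk : ∀ i, X i → (g i).Site) (blkY : ∀ i, Y i → (g i).Site) (q : ∀ i, X i × ι → Y i)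
  (π : ∀ i, X' i → X i) (nsh : I → ℕ) (hL0 : ∀ i, (g i).L ≠ 0) (θ : I → ℝ)
  (G : ∀ i, (X i × ι → ℝ) →ₗ[ℝ] (X i × ι → ℝ)) (D : ∀ i, J ⊕ J → (X i × ι → ℝ) →ₗ[ℝ] (X i × ι → ℝ))
  (G' : ∀ i, (X' i × ι → ℝ) →ₗ[ℝ] (X' i × ι → ℝ)) (D' : ∀ i, J ⊕ J → (X' i × ι → ℝ) →ₗ[ℝ] (X' i × ι → ℝ))
  (s : ∀ i, J → X i ≃ X i) (s' : ∀ i, J → X' i ≃ X' i) (Cπ : I → ℝ) (Nst Nf : I → ℕ)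
  (Wc : ∀ i, (J → X' i → 𝔄) → ((X i × ι → ℝ) →ₗ[ℝ] (X i × ι → ℝ))) (Wf : ∀ i, (J → X' i → 𝔄) → ((X' i × ι → ℝ) →ₗ[ℝ] (X' i × ι → ℝ)))
  (Fc : ∀ i, (J → X' i → 𝔄) → ((X i × ι → ℝ) →ₗ[ℝ] (Y i → ℝ))) (Fsc : ∀ i, (J → X' i → 𝔄) → ((Y i → ℝ) →ₗ[ℝ] (X i × ι → ℝ)))
  (Ff : ∀ i, (J → X' i → 𝔄) → ((X' i × ι → ℝ) →ₗ[ℝ] (Y i → ℝ))) (Fsf : ∀ i, (J → X' i → 𝔄) → ((Y i → ℝ) →ₗ[ℝ] (X' i × ι → ℝ)))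
  (Ws Ws' Ku Ku' : ∀ i, (Y i → ℝ) →ₗ[ℝ] (Y i → ℝ)) (a : ℝ)

/-- THE UNIT-LAYER OPS at a fine gauge field `A′` of instance `i`: the η-difference (common site lattice, identity transports) of the fine dressed unit covariance at `A′`
(spacing `η′_i = η_i(L^{n_i})⁻¹`, `V′₁` coefficients at the fine triple, word `Wf i A′`, species `Ff i A′`, `Fsf i A′`, `U ≡ 1` unit covariance `Ws′ i`) and the coarse one at
the mean field's triple (`η_i`, `Wc i A′`, `Fc i A′`, `Fsc i A′`, `Ws i`). [cite: King1986, (4.33) p.673 + Lemma 4.5 (4.38) p.674 (shapes)] -/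
def vWUnitRelOpsC (i : I) : (J → X' i → 𝔄) → ((Y i → ℝ) →ₗ[ℝ] (Y i → ℝ)) := fun A' =>
  idef LinearMap.id LinearMap.id
    (siteInv (Ws' i) (Ku' i) (Ku' i + (unitForm a (q i ∘ liftMap (π i) ι) (Ff i A') (Fsf i A')
      (dressedOp (G' i) (D' i) (vWPert (v1coefC e ((g i).eta * ((g i).L ^ nsh i)⁻¹) (v1fieldsOfGauge 𝔄 J (s' i) ((g i).eta * ((g i).L ^ nsh i)⁻¹) A'))
        (v1coefA e ((g i).eta * ((g i).L ^ nsh i)⁻¹) (v1fieldsOfGauge 𝔄 J (s' i) ((g i).eta * ((g i).L ^ nsh i)⁻¹) A')) (Wf i A'))) -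
      unitForm₀ a (q i ∘ liftMap (π i) ι) (G' i))))
    (siteInv (Ws i) (Ku i) (Ku i + (unitForm a (q i) (Fc i A') (Fsc i A')
      (dressedOp (G i) (D i) (vWPert (v1coefC e (g i).eta (v1fieldsOfGauge 𝔄 J (s i) (g i).eta (gavgM 𝔄 J (π i) A')))
        (v1coefA e (g i).eta (v1fieldsOfGauge 𝔄 J (s i) (g i).eta (gavgM 𝔄 J (π i) A'))) (Wc i A'))) -
      unitForm₀ a (q i) (G i))))

/-- THE UNIT-COVARIANCE KERNEL FAMILY on g3's gauge paired instances: `siteKernelOf` of `vWUnitOpsC`. [cite: Balaban1985BackgroundPropagators, Thm 3.15 (3.187) p.432 (shape)] -/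
def vWGCUnitRelKernel (i : I) :
    B9.SiteKernel (v1GaugeInstance 𝔄 J ι (blk i) (π i) (s i) (s' i) (nsh i) (hL0 i)).gc (v1GaugeInstance 𝔄 J ι (blk i) (π i) (s i) (s' i) (nsh i) (hL0 i)).Bf :=
  show B9.SiteKernel (opGeo (g i) (X i × ι) (liftBlk (blk i) ι)) (v1GaugeBg 𝔄 J (s' i) ((g i).eta * ((g i).L ^ nsh i)⁻¹) (g i).M) from
    siteKernelOf (liftBlk (blk i) ι) (blkY i) (vWUnitRelOpsC e g X X' Y q π nsh G D G' D' s s' Wc Wf Fc Fsc Ff Fsf Ws Ws' Ku Ku' a i)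
set_option maxHeartbeats 400000 in
/-- **NE2⁺, UNIT-LATTICE LAYER — `T4EtaRate.NE2PlusUnit c₃₅` BY NAME, (3.60)-SHAPED FULL PERTURBATION LIVE, GAUGE FIELD THE DATUM** — S5's `ne2PlusSite_vWGC` for the
dressed unit covariances: the SAME gauge paired instances and structural hypotheses, PLUS a uniform rate number `0 < θ₀ < 1` with `θ_i ≤ θ₀^{k_i}` and `M_i ≥ 1` (the unit
layer's quantifier block has no `M₅` guard), the `U ≡ 1` UNIT COVARIANCES `Ws i, Ws′ i` (uniform majorant `β_W·e^{−δd}`, inverting `a − a²QGQ*` ∕ `a − a²Q′G′Q′*`) ⟹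
`NE2PlusUnit c₃₅ pi (vWGCUnitKernel …) ⊤ d` (inside: `δ₀ = δ − 4σ`, `a₀ = min a₁ a₂`, `B₀ = uAmp + 1`, `θ = θ₀`; the (3.36) slot is not consumed).  NOT PRINTED (no η-rate is);
N15's third conjunct for a background-live family, the `U ≡ 1` unit covariances displayed. [cite: Balaban1985BackgroundPropagators, Thm 3.15 (3.187) p.432 (quantifier template); King1986, (4.33) p.673, Lemma 4.5 (4.38) p.674 (shapes); Balaban1985BackgroundPropagators, (3.35) p.396, (3.60) p.402, (3.65)–(3.67) p.403 (shapes, mechanism)] -/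
theorem ne2PlusUnit_vWGC_rel (c35 : ℝ) (hc35 : 0 < c35) {θ₀ : ℝ} (hθ₀ : 0 < θ₀) (hθ₁ : θ₀ < 1) (hθk : ∀ i, θ i ≤ θ₀ ^ (g i).k)
    (hM1 : ∀ i, 1 ≤ (g i).M) {M₀ : ℝ} (hM₀ : 0 ≤ M₀)
    (htri : ∀ i, Triangle254 (g i)) (hd : ∀ i (a b : (g i).Site), 0 ≤ (g i).dist a b) {σ cr : ℝ} (hσ : 0 ≤ σ) (hcr : 0 ≤ cr)
    (hrow : ∀ i, RowSum (g i) σ cr) (hη : ∀ i, 0 < (g i).eta) (hη1 : ∀ i, (g i).eta ≤ 1) (hηθ : ∀ i, (g i).eta ≤ θ i) (hL : ∀ i, 1 ≤ (g i).L)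
    {δ β m₀ cW cF βW : ℝ} (hσδ : 4 * σ < δ) (hβ : 0 ≤ β) (hm₀ : 0 ≤ m₀)
    (hcomm : ∀ i μ κ x, (s' i μ).symm (s' i κ x) = s' i κ ((s' i μ).symm x)) (hCπ : ∀ i, 0 ≤ Cπ i)
    (hconn : ∀ i (f : X' i → 𝔄) (b : ℝ), (∀ κ x, ‖f (s' i κ x) - f x‖ ≤ b) → ∀ x₁ x₂, π i x₁ = π i x₂ → ‖f x₁ - f x₂‖ ≤ Cπ i * b)
    {C₀ : ℝ} (hC₀ : 0 ≤ C₀) (hCθ : ∀ i, Cπ i * ((g i).eta * ((g i).L ^ nsh i)⁻¹) ≤ C₀ * θ i) (hcW : 0 ≤ cW) (hcF : 0 ≤ cF) (hβW : 0 ≤ βW)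
    (hblk : ∀ i μ x', π i ((s' i μ ^ Nst i) x') = s i μ (π i x')) (hN : ∀ i, (g i).eta = Nst i * ((g i).eta * ((g i).L ^ nsh i)⁻¹))
    (hqY : ∀ i pt, liftBlk (blk i) ι pt = blkY i (q i pt)) (hNf : ∀ i, Nf i ≠ 0) (hfib : ∀ i x, (fibre (liftMap (π i) ι) x).card = Nf i)
    (hWc : ∀ i (α₀ : ℝ) A', 0 < α₀ → 2 * (c35 * ((g i).M * α₀)) ≤ 1 → (v1GaugeBg 𝔄 J (s' i) ((g i).eta * ((g i).L ^ nsh i)⁻¹) (g i).M).Reg335 c35 α₀ A' →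
      HasMaj (BlockNorm.ofBlocks (g i) (liftBlk (blk i) ι)) (BlockNorm.ofBlocks (g i) (liftBlk (blk i) ι)) (Wc i A') (diagK fun _ => cW * (c35 * (g i).M * α₀)))
    (hWf : ∀ i (α₀ : ℝ) A', 0 < α₀ → 2 * (c35 * ((g i).M * α₀)) ≤ 1 → (v1GaugeBg 𝔄 J (s' i) ((g i).eta * ((g i).L ^ nsh i)⁻¹) (g i).M).Reg335 c35 α₀ A' →
      HasMaj (BlockNorm.ofBlocks (g i) (liftBlk (blk i ∘ π i) ι)) (BlockNorm.ofBlocks (g i) (liftBlk (blk i ∘ π i) ι)) (Wf i A')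
        (diagK fun _ => cW * (c35 * (g i).M * α₀)))
    (hDW : ∀ i (α₀ : ℝ) A', 0 < α₀ → 2 * (c35 * ((g i).M * α₀)) ≤ 1 → (v1GaugeBg 𝔄 J (s' i) ((g i).eta * ((g i).L ^ nsh i)⁻¹) (g i).M).Reg335 c35 α₀ A' →
      HasMaj (BlockNorm.ofBlocks (g i) (liftBlk (blk i) ι)) (BlockNorm.ofBlocks (g i) (liftBlk (blk i ∘ π i) ι))
        (idef (pull (liftMap (π i) ι)) (pull (liftMap (π i) ι)) (Wf i A') (Wc i A')) (diagK fun _ => cW * (c35 * (g i).M * α₀) * θ i))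
    (hFc : ∀ i (α₀ : ℝ) A', 0 < α₀ → 2 * (c35 * ((g i).M * α₀)) ≤ 1 → (v1GaugeBg 𝔄 J (s' i) ((g i).eta * ((g i).L ^ nsh i)⁻¹) (g i).M).Reg335 c35 α₀ A' →
      HasMaj (BlockNorm.ofBlocks (g i) (liftBlk (blk i) ι)) (BlockNorm.ofBlocks (g i) (blkY i)) (Fc i A') (diagK fun _ => cF * (c35 * (g i).M * α₀)))
    (hFsc : ∀ i (α₀ : ℝ) A', 0 < α₀ → 2 * (c35 * ((g i).M * α₀)) ≤ 1 → (v1GaugeBg 𝔄 J (s' i) ((g i).eta * ((g i).L ^ nsh i)⁻¹) (g i).M).Reg335 c35 α₀ A' →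
      HasMaj (BlockNorm.ofBlocks (g i) (blkY i)) (BlockNorm.ofBlocks (g i) (liftBlk (blk i) ι)) (Fsc i A') (diagK fun _ => cF * (c35 * (g i).M * α₀)))
    (hFf : ∀ i (α₀ : ℝ) A', 0 < α₀ → 2 * (c35 * ((g i).M * α₀)) ≤ 1 → (v1GaugeBg 𝔄 J (s' i) ((g i).eta * ((g i).L ^ nsh i)⁻¹) (g i).M).Reg335 c35 α₀ A' →
      HasMaj (BlockNorm.ofBlocks (g i) (liftBlk (blk i ∘ π i) ι)) (BlockNorm.ofBlocks (g i) (blkY i)) (Ff i A') (diagK fun _ => cF * (c35 * (g i).M * α₀)))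
    (hFsf : ∀ i (α₀ : ℝ) A', 0 < α₀ → 2 * (c35 * ((g i).M * α₀)) ≤ 1 → (v1GaugeBg 𝔄 J (s' i) ((g i).eta * ((g i).L ^ nsh i)⁻¹) (g i).M).Reg335 c35 α₀ A' →
      HasMaj (BlockNorm.ofBlocks (g i) (blkY i)) (BlockNorm.ofBlocks (g i) (liftBlk (blk i ∘ π i) ι)) (Fsf i A') (diagK fun _ => cF * (c35 * (g i).M * α₀)))
    (hDF : ∀ i (α₀ : ℝ) A', 0 < α₀ → 2 * (c35 * ((g i).M * α₀)) ≤ 1 → (v1GaugeBg 𝔄 J (s' i) ((g i).eta * ((g i).L ^ nsh i)⁻¹) (g i).M).Reg335 c35 α₀ A' →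
      HasMaj (BlockNorm.ofBlocks (g i) (liftBlk (blk i) ι)) (BlockNorm.ofBlocks (g i) (blkY i))
        (idef (pull (liftMap (π i) ι)) LinearMap.id (Ff i A') (Fc i A')) (diagK fun _ => cF * (c35 * (g i).M * α₀) * θ i))
    (hDFs : ∀ i (α₀ : ℝ) A', 0 < α₀ → 2 * (c35 * ((g i).M * α₀)) ≤ 1 → (v1GaugeBg 𝔄 J (s' i) ((g i).eta * ((g i).L ^ nsh i)⁻¹) (g i).M).Reg335 c35 α₀ A' →
      HasMaj (BlockNorm.ofBlocks (g i) (blkY i)) (BlockNorm.ofBlocks (g i) (liftBlk (blk i ∘ π i) ι))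
        (idef LinearMap.id (pull (liftMap (π i) ι)) (Fsf i A') (Fsc i A')) (diagK fun _ => cF * (c35 * (g i).M * α₀) * θ i))
    (hG : ∀ i, HasMaj (BlockNorm.ofBlocks (g i) (liftBlk (blk i) ι)) (BlockNorm.ofBlocks (g i) (liftBlk (blk i) ι)) (G i)
      (fun y y' => β * Real.exp (-(δ * (g i).dist y y'))))
    (hD : ∀ i μ, HasMaj (BlockNorm.ofBlocks (g i) (liftBlk (blk i) ι)) (BlockNorm.ofBlocks (g i) (liftBlk (blk i) ι)) (D i μ)
      (fun y y' => β * Real.exp (-(δ * (g i).dist y y'))))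
    (hG' : ∀ i, HasMaj (BlockNorm.ofBlocks (g i) (liftBlk (blk i ∘ π i) ι)) (BlockNorm.ofBlocks (g i) (liftBlk (blk i ∘ π i) ι)) (G' i)
      (fun y y' => β * Real.exp (-(δ * (g i).dist y y'))))
    (hD' : ∀ i μ, HasMaj (BlockNorm.ofBlocks (g i) (liftBlk (blk i ∘ π i) ι)) (BlockNorm.ofBlocks (g i) (liftBlk (blk i ∘ π i) ι)) (D' i μ)
      (fun y y' => β * Real.exp (-(δ * (g i).dist y y'))))
    (hDG : ∀ i, HasMaj (BlockNorm.ofBlocks (g i) (liftBlk (blk i) ι)) (BlockNorm.ofBlocks (g i) (liftBlk (blk i ∘ π i) ι))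
      (idef (pull (liftMap (π i) ι)) (pull (liftMap (π i) ι)) (G' i) (G i)) (fun y y' => m₀ * θ i * Real.exp (-(δ * (g i).dist y y'))))
    (hDD : ∀ i μ, HasMaj (BlockNorm.ofBlocks (g i) (liftBlk (blk i) ι)) (BlockNorm.ofBlocks (g i) (liftBlk (blk i ∘ π i) ι))
      (idef (pull (liftMap (π i) ι)) (pull (liftMap (π i) ι)) (D' i μ) (D i μ)) (fun y y' => m₀ * θ i * Real.exp (-(δ * (g i).dist y y'))))
    (hWs : ∀ i, HasMaj (BlockNorm.ofBlocks (g i) (blkY i)) (BlockNorm.ofBlocks (g i) (blkY i)) (Ws i) (fun y y' => βW * Real.exp (-(δ * (g i).dist y y'))))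
    (hWs' : ∀ i, HasMaj (BlockNorm.ofBlocks (g i) (blkY i)) (BlockNorm.ofBlocks (g i) (blkY i)) (Ws' i) (fun y y' => βW * Real.exp (-(δ * (g i).dist y y'))))
    (hKW : ∀ i, Ku i ∘ₗ Ws i = LinearMap.id) (hKW' : ∀ i, Ku' i ∘ₗ Ws' i = LinearMap.id)
    (hDKu : ∀ i, HasMaj (BlockNorm.ofBlocks (g i) (blkY i)) (BlockNorm.ofBlocks (g i) (blkY i)) (idef LinearMap.id LinearMap.id (Ku' i) (Ku i))
      (fun y y' => M₀ * θ i * Real.exp (-(δ * (g i).dist y y')))) :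
    NE2PlusUnit c35 (fun i => v1GaugeInstance 𝔄 J ι (blk i) (π i) (s i) (s' i) (nsh i) (hL0 i))
      (vWGCUnitRelKernel e g X X' Y blk blkY q π nsh hL0 G D G' D' s s' Wc Wf Fc Fsc Ff Fsf Ws Ws' Ku Ku' a) (fun _ _ => True) (fun i => (g i).dist) := by
  have hJ0 : (0 : ℝ) ≤ Fintype.card J := Nat.cast_nonneg _
  set c' : ℝ := (2 + Fintype.card J) * (1 + C₀) * c35 with hc'
  have hc'pos : 0 < c' := by positivity
  have hc35c' : c35 ≤ 2 * c' := by
    rw [hc']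
    have h1 : (1 : ℝ) ≤ 2 * ((2 + Fintype.card J) * (1 + C₀)) := by nlinarith [mul_nonneg hJ0 hC₀]
    nlinarith
  have h2c'pos : 0 < 2 * c' := by positivity
  obtain ⟨hcg, hgpos, _⟩ := le_gVWc35 (J := J) (basisConst_nonneg e) h2c'pos hcW
  have hP : 0 ≤ a * a * cLinU β (gVWc35 J (basisConst e) (2 * c') cW) cr (cF * (2 * c')) :=
    mul_nonneg (mul_self_nonneg a) (cLinU_nonneg hβ hgpos.le hcr (by positivity))
  obtain ⟨a₀, ha₀, ha₀le, hq, ha₀1, hq2P⟩ := site_thresholds hβ hcr hgpos hcg hc'pos hP hβW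
  have hq2 : βW * (a * a * cAmpU β (gVWc35 J (basisConst e) (2 * c') cW * a₀) cr (cF * (2 * c') * a₀)) * cr * cr ≤ 1 / 2 := by
    have hle := cAmpU_le_lin (β := β) (K := gVWc35 J (basisConst e) (2 * c') cW) (cr := cr) (rK := cF * (2 * c')) hβ hgpos.le hcr (by positivity)
      ha₀.le ha₀le hq
    have hle' : a * a * cAmpU β (gVWc35 J (basisConst e) (2 * c') cW * a₀) cr (cF * (2 * c') * a₀) ≤
        a₀ * (a * a * cLinU β (gVWc35 J (basisConst e) (2 * c') cW) cr (cF * (2 * c'))) := by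
      have := mul_le_mul_of_nonneg_left hle (mul_self_nonneg a)
      linarith [this]
    have h1 : βW * (a * a * cAmpU β (gVWc35 J (basisConst e) (2 * c') cW * a₀) cr (cF * (2 * c') * a₀)) * cr * cr ≤
        βW * (a₀ * (a * a * cLinU β (gVWc35 J (basisConst e) (2 * c') cW) cr (cF * (2 * c')))) * cr * cr :=
      mul_le_mul_of_nonneg_right (mul_le_mul_of_nonneg_right (mul_le_mul_of_nonneg_left hle' hβW) hcr) hcr
    exact h1.trans hq2P
  have hqlt : β * (gVWc35 J (basisConst e) (2 * c') cW * a₀) * cr < 1 := by linarith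
  have hq2lt : βW * (a * a * cAmpU β (gVWc35 J (basisConst e) (2 * c') cW * a₀) cr (cF * (2 * c') * a₀)) * cr * cr < 1 := by linarith
  have hC : 0 ≤ uAmpRel β (gVWc35 J (basisConst e) (2 * c') cW * a₀) cr (cF * (2 * c') * a₀) m₀ (gVWc35 J (basisConst e) (2 * c') cW) a₀
      (cF * (2 * c') * a₀) βW a M₀ := uAmpRel_nonneg hβ hcr (by positivity) hm₀ hgpos.le ha₀.le (by positivity) hβW hM₀ hqlt hq2lt
  generalize hCdef : uAmpRel β (gVWc35 J (basisConst e) (2 * c') cW * a₀) cr (cF * (2 * c') * a₀) m₀ (gVWc35 J (basisConst e) (2 * c') cW) a₀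
      (cF * (2 * c') * a₀) βW a M₀ = C at hC
  refine ⟨δ - 4 * σ, a₀, C + 1, θ₀, by linarith, ha₀, by linarith, hθ₀, hθ₁, fun i α₀ hα₀ hMα A' hreg _ => ?_⟩
  have hM' : 1 ≤ (g i).M := hM1 i; have hMα' : (g i).M * α₀ ≤ a₀ := hMα; have hM0 : 0 ≤ (g i).M := zero_le_one.trans hM'
  have hLpos : 0 < (g i).L := lt_of_lt_of_le one_pos (hL i)
  have hη'pos : 0 < (g i).eta * ((g i).L ^ nsh i)⁻¹ := mul_pos (hη i) (inv_pos.2 (pow_pos hLpos _))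
  have hη'η : (g i).eta * ((g i).L ^ nsh i)⁻¹ ≤ (g i).eta := by
    have h1 : ((g i).L ^ nsh i)⁻¹ ≤ 1 := inv_le_one_of_one_le₀ (one_le_pow₀ (hL i))
    calc (g i).eta * ((g i).L ^ nsh i)⁻¹ ≤ (g i).eta * 1 := mul_le_mul_of_nonneg_left h1 (hη i).le
      _ = (g i).eta := mul_one _
  have hθ0 : 0 ≤ θ i := (hη i).le.trans (hηθ i)
  have hcc' : (2 + Fintype.card J) * c35 ≤ c' := by
    rw [hc']
    have h0 : 0 ≤ (2 + Fintype.card J) * c35 := by positivity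
    nlinarith [mul_nonneg hC₀ h0]
  have hθ' : (1 + Fintype.card J) * Cπ i * (c35 * (g i).M * α₀) * ((g i).eta * ((g i).L ^ nsh i)⁻¹) ≤ c' * (g i).M * α₀ * θ i := by
    have h0 : 0 ≤ (1 + Fintype.card J) * (c35 * (g i).M * α₀) := by positivity
    have hMα0 : 0 ≤ (g i).M * α₀ := mul_nonneg hM0 hα₀.le
    have hcoef : (1 + Fintype.card J) * C₀ * c35 ≤ c' := by
      rw [hc']; nlinarith [mul_nonneg hC₀ hJ0, hc35.le, mul_nonneg (mul_nonneg hC₀ hJ0) hc35.le, mul_nonneg hJ0 hc35.le, mul_nonneg hC₀ hc35.le]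
    calc (1 + Fintype.card J) * Cπ i * (c35 * (g i).M * α₀) * ((g i).eta * ((g i).L ^ nsh i)⁻¹)
        = (1 + Fintype.card J) * (c35 * (g i).M * α₀) * (Cπ i * ((g i).eta * ((g i).L ^ nsh i)⁻¹)) := by ring
      _ ≤ (1 + Fintype.card J) * (c35 * (g i).M * α₀) * (C₀ * θ i) := mul_le_mul_of_nonneg_left (hCθ i) h0
      _ = ((1 + Fintype.card J) * C₀ * c35) * ((g i).M * α₀) * θ i := by ring
      _ ≤ c' * ((g i).M * α₀) * θ i := mul_le_mul_of_nonneg_right (mul_le_mul_of_nonneg_right hcoef hMα0) hθ0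
      _ = c' * (g i).M * α₀ * θ i := by ring
  have hregA : (v1GaugeBg 𝔄 J (s' i) ((g i).eta * ((g i).L ^ nsh i)⁻¹) (g i).M).Reg335 c35 α₀ A' := hreg
  have hmono : c35 * (g i).M * α₀ ≤ 2 * c' * (g i).M * α₀ := mul_le_mul_of_nonneg_right (mul_le_mul_of_nonneg_right hc35c' hM0) hα₀.le
  have hmW : cW * (c35 * (g i).M * α₀) ≤ cW * (2 * c' * (g i).M * α₀) := mul_le_mul_of_nonneg_left hmono hcW
  have hmF : cF * (c35 * (g i).M * α₀) ≤ cF * (2 * c' * (g i).M * α₀) := mul_le_mul_of_nonneg_left hmono hcF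
  have hsm : 2 * (c35 * ((g i).M * α₀)) ≤ 1 :=
    (mul_le_mul_of_nonneg_left ((mul_le_mul_of_nonneg_left hMα' hc35.le).trans (mul_le_mul_of_nonneg_right hc35c' ha₀.le)) zero_le_two).trans ha₀1
  have hWc' := (hWc i α₀ A' hα₀ hsm hregA).mono fun y y' => diagK_mono (fun _ => hmW) y y'
  have hWf' := (hWf i α₀ A' hα₀ hsm hregA).mono fun y y' => diagK_mono (fun _ => hmW) y y'
  have hDW' := (hDW i α₀ A' hα₀ hsm hregA).mono fun y y' => diagK_mono (fun _ => mul_le_mul_of_nonneg_right hmW hθ0) y y'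
  have hFc' := (hFc i α₀ A' hα₀ hsm hregA).mono fun y y' => diagK_mono (fun _ => hmF) y y'
  have hFsc' := (hFsc i α₀ A' hα₀ hsm hregA).mono fun y y' => diagK_mono (fun _ => hmF) y y'
  have hFf' := (hFf i α₀ A' hα₀ hsm hregA).mono fun y y' => diagK_mono (fun _ => hmF) y y'
  have hFsf' := (hFsf i α₀ A' hα₀ hsm hregA).mono fun y y' => diagK_mono (fun _ => hmF) y y'
  have hDF' := (hDF i α₀ A' hα₀ hsm hregA).mono fun y y' => diagK_mono (fun _ => mul_le_mul_of_nonneg_right hmF hθ0) y y'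
  have hDFs' := (hDFs i α₀ A' hα₀ hsm hregA).mono fun y y' => diagK_mono (fun _ => mul_le_mul_of_nonneg_right hmF hθ0) y y'
  have key := hasMaj_idef_vWUnitRelC e (blk i) (blkY i) (q i) (π i) a (htri i) (hd i) hσ hcr (hrow i) hσδ.le hβ hm₀ hθ0 (hcomm i) (hCπ i) (hconn i) (hblk i)
    hη'pos hη'η (hη1 i) (hηθ i) (hN i) hc35.le hc'pos hcc' hθ' hM' hα₀ hMα' ha₀.le ha₀1 hq hcW hcF hβW hq2 (hqY i) (hNf i) (hfib i) (hG i) (hD i) (hG' i)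
    (hD' i) (hDG i) (hDD i) hregA hWc' hWf' hDW' hFc' hFsc' hFf' hFsf' hDF' hDFs' hM₀ (hWs i) (hWs' i) (hKW i) (hKW' i) (hDKu i)
  rw [hCdef] at key
  have key' : HasMaj (BlockNorm.ofBlocks (g i) (blkY i)) (BlockNorm.ofBlocks (g i) (blkY i))
      (vWUnitRelOpsC e g X X' Y q π nsh G D G' D' s s' Wc Wf Fc Fsc Ff Fsf Ws Ws' Ku Ku' a i A')
      (fun y y' => (C + 1) * Real.exp (-((δ - 4 * σ) * (g i).dist y y')) * θ₀ ^ (g i).k) := by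
    refine key.mono fun y y' => ?_
    have hE : 0 ≤ Real.exp (-((δ - 4 * σ) * (g i).dist y y')) := Real.exp_nonneg _
    calc C * θ i * Real.exp (-((δ - 4 * σ) * (g i).dist y y'))
        = C * Real.exp (-((δ - 4 * σ) * (g i).dist y y')) * θ i := by ring
      _ ≤ (C + 1) * Real.exp (-((δ - 4 * σ) * (g i).dist y y')) * θ₀ ^ (g i).k :=
          mul_le_mul (mul_le_mul_of_nonneg_right (by linarith) hE) (hθk i) hθ0 (mul_nonneg (by linarith) hE)
  have hC1 : 0 ≤ C + 1 := by linarith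
  have fin := etaRateIneqUnit_opGeo_of_hasMaj (B := v1GaugeBg 𝔄 J (s' i) ((g i).eta * ((g i).L ^ nsh i)⁻¹) (g i).M)
    (liftBlk (blk i) ι) (blkY i) (g i).k hC1 hθ₀.le (vWUnitRelOpsC e g X X' Y q π nsh G D G' D' s s' Wc Wf Fc Fsc Ff Fsf Ws Ws' Ku Ku' a i) A' key'
  intro y y' hy hy'
  exact fin y y' hy hy'

end Node

end Summit.QuantumFields.YangMills.BalabanUVNodes.N15.SiteLayer

end
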